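import Mathlib
import Literature.Computability.AlgebraicComplexity.Apolarity
import Literature.Computability.AlgebraicComplexity.ApolarityAction
import Summits.ValiantsHypothesis.ValiantsHypothesis.Theorems.BorderApolarityFixedWitnessObstructionQPKuratowskiSubmodule
import Summits.ValiantsHypothesis.ValiantsHypothesis.Theorems.BorderApolarityFixedWitnessObstructionQPAnnSubmodule
import Summits.ValiantsHypothesis.ValiantsHypothesis.Theorems.BorderApolarityToricFixedPointsCellRetractionAux2

/-!
# Border apolarity, crux `ToricFixedPoints` — sequential continuity of the BB retraction (S3)

Route `ValiantsHypothesis/BorderApolarity`, crux item `stmt-ValiantsHypothesis-5779`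
(`Summit.ValiantsHypothesis.ValiantsHypothesis.Theses.BorderApolarity.ToricFixedPoints`), line
`bb-cell-state-polytope`, stub `stub_cellRetraction` (S3 of the lead's skeleton): if
`Ann_•(P'_t) → J` degree-wise (`k ≤ m`, Kuratowski limits in the coefficient topology, i.e.
`IsBorderApolarLimit m P' J`), `J` is `μ`-graded, and for all `t`, `k ≤ m`, `ν` the
`μ`-filtration rank `dim span(Ann_k(P'_t) ∩ S_{≥ν})` equals that of `J k`, then the initial
spans `in_μ(Ann_k(P'_t))` — spans of the LOWEST-`μ`-weight forms, the Białynicki-Birula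
retraction for the cocharacter `μ` of the diagonal torus — Kuratowski-converge to `J` as well.

Proof (`cr_core`, degree by degree; `A_t := Ann_k(P'_t)`,
`π_ν := weightedHomogeneousComponent μ ν`, `S_{≥ν}` the filtration pieces,
`r_ν := dim (A_t ∩ S_{≥ν}) = dim (J_k ∩ S_{≥ν})` the pinned ranks).
1. `A_t`, `J_k` are subspaces of the degree-`k` forms (`exists_annSubmodule`,
   `exists_submodule_coe_eq`), and the rank hypothesis reads
   `dim (A_t ⊓ S_{≥ν}) = dim (J_k ⊓ S_{≥ν})`.
2. Filtered pieces: `A_t ⊓ S_{≥ν} → J_k ⊓ S_{≥ν}` Kuratowski — (Ls) since `S_{≥ν}` is closed,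
   (Li) by sequential compactness of the Grassmannian and the pinned dimension
   (`cr_coeff_li_of_ls`).
3. Graded pieces: `π_ν(A_t ⊓ S_{≥ν}) → π_ν(J_k ⊓ S_{≥ν})` — their dimensions `r_ν - r_{ν+1}`
   are pinned (rank–nullity, `S_{≥ν} ⊓ ker π_ν = S_{≥ν+1}`); (Li) by continuity of `π_ν`,
   (Ls) by `cellRetraction_coeff_ls_of_li`.
4. Assembly: `π_ν(A_t ⊓ S_{≥ν}) ⊆ in_μ(A_t)` (a nonzero `π_ν E`, `E ∈ S_{≥ν}`, is the lowest
   form of `E`) and `π_ν(in_μ(A_t)) ⊆ π_ν(A_t ⊓ S_{≥ν})` (a lowest form of weight `ν₀` comes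
   from `E ∈ S_{≥ν₀}`); `J_k` being graded, `π_ν D ∈ π_ν(J_k ⊓ S_{≥ν}) ⊆ J_k` for `D ∈ J_k`;
   sum over the finitely many weights of the monomials of `D` (`D = Σ_ν π_ν D`).
No orbit or fixedness hypothesis is used.
-/

open Filter Module
open scoped Topology

namespace Summit.ValiantsHypothesis.ValiantsHypothesis.Theorems.BorderApolarityToricFixedPoints

/-! ## The stub -/

section Main

open MvPolynomial
open Literature.Computability.AlgebraicComplexity
open Summit.ValiantsHypothesis.ValiantsHypothesis.Theorems.BorderApolarityFixedWitnessObstructionQP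
  (exists_submodule_coe_eq exists_annSubmodule)

/-- **Core of `stub_cellRetraction`, degree by degree.**  For `k ≤ m`: with `A_t = Ann_k(P'_t)`,
`J_k` their Kuratowski limit, `J` `μ`-graded and the filtration ranks `dim (A_t ∩ S_{≥ν})` pinned to
those of `J_k`, the initial spans `in_μ(A_t)` Kuratowski-converge to `J_k`.  Steps: the filtered
pieces `A_t ∩ S_{≥ν} → J_k ∩ S_{≥ν}` ((Ls) by closedness, (Li) by `cr_coeff_li_of_ls`); the graded
pieces `π_ν(A_t ∩ S_{≥ν}) → π_ν(J_k ∩ S_{≥ν})` ((Li) by continuity of `π_ν`, (Ls) by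
`cellRetraction_coeff_ls_of_li`, the dimensions `r_ν - r_{ν+1}` being pinned); assemble over the weights, using
`in_μ(A_t) = ⊕_ν π_ν(A_t ∩ S_{≥ν})` and `J_k = ⊕_ν π_ν(J_k ∩ S_{≥ν})`. [folklore] -/
theorem cr_core (m : ℕ) (J : ℕ → Set (MvPolynomial (Fin m × Fin m) ℂ)) (μ : Fin m × Fin m → ℤ)
    (P' : ℕ → MvPolynomial (Fin m × Fin m) ℂ) (hlim : IsBorderApolarLimit m P' J)
    (hgr : ∀ k ≤ m, ∀ D ∈ J k, ∀ ν : ℤ, weightedHomogeneousComponent μ ν D ∈ J k)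
    (hrk : ∀ t : ℕ, ∀ k ≤ m, ∀ ν : ℤ,
      Module.finrank ℂ ↥(Submodule.span ℂ (annihilatorOfDegree (P' t) k ∩
        {D : MvPolynomial (Fin m × Fin m) ℂ | ∀ e ∈ D.support, ν ≤ Finsupp.weight μ e})) =
      Module.finrank ℂ ↥(Submodule.span ℂ (J k ∩
        {D : MvPolynomial (Fin m × Fin m) ℂ | ∀ e ∈ D.support, ν ≤ Finsupp.weight μ e})))
    (k : ℕ) (hk : k ≤ m) :
    (∀ D ∈ J k, ∃ Ds : ℕ → MvPolynomial (Fin m × Fin m) ℂ,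
        (∀ t, Ds t ∈ Submodule.span ℂ {D' : MvPolynomial (Fin m × Fin m) ℂ |
            ∃ E ∈ annihilatorOfDegree (P' t) k, ∃ ν : ℤ, D' = weightedHomogeneousComponent μ ν E ∧
              ∀ ν' : ℤ, ν' < ν → weightedHomogeneousComponent μ ν' E = 0}) ∧
          Filter.Tendsto (fun t => coeffVec (Ds t)) Filter.atTop (nhds (coeffVec D))) ∧
    (∀ (D : MvPolynomial (Fin m × Fin m) ℂ) (φ : ℕ → ℕ) (Ds : ℕ → MvPolynomial (Fin m × Fin m) ℂ),
        StrictMono φ →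
        (∀ t, Ds t ∈ Submodule.span ℂ {D' : MvPolynomial (Fin m × Fin m) ℂ |
            ∃ E ∈ annihilatorOfDegree (P' (φ t)) k, ∃ ν : ℤ, D' = weightedHomogeneousComponent μ ν E ∧
              ∀ ν' : ℤ, ν' < ν → weightedHomogeneousComponent μ ν' E = 0}) →
        Filter.Tendsto (fun t => coeffVec (Ds t)) Filter.atTop (nhds (coeffVec D)) → D ∈ J k) := by
  classical
  -- the annihilators and the limit as submodules of the degree-`k` forms
  have hA := fun t => exists_annSubmodule k (P' t)
  choose 𝒜 h𝒜 h𝒜hom _h𝒜dim using hA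
  have hmemA : ∀ t D, D ∈ 𝒜 t ↔ D ∈ annihilatorOfDegree (P' t) k := fun t D => by
    rw [← SetLike.mem_coe, h𝒜]
  obtain ⟨𝒥, h𝒥⟩ := exists_submodule_coe_eq 𝒜 (J k)
    (fun D hD => by
      obtain ⟨Ds, hDs, hl⟩ := hlim.exists_tendsto hk hD
      exact ⟨Ds, fun t => (hmemA t _).2 (hDs t), hl⟩)
    (fun D φ Ds hφ hDs hl => hlim.mem_of_tendsto hk hφ (fun t => (hmemA _ _).1 (hDs t)) hl)
  have hmemJ : ∀ D, D ∈ 𝒥 ↔ D ∈ J k := fun D => by rw [← SetLike.mem_coe, h𝒥]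
  have h𝒥hom : 𝒥 ≤ homogeneousSubmodule (Fin m × Fin m) ℂ k := fun D hD =>
    (mem_homogeneousSubmodule k D).2 (hlim.isHomogeneous_of_mem hk ((hmemJ D).1 hD))
  -- the filtration
  obtain ⟨S, hS⟩ := cr_exists_filt (σ := Fin m × Fin m) μ
  -- pinned ranks
  have hrank : ∀ t ν, Module.finrank ℂ ↥(𝒜 t ⊓ S ν) = Module.finrank ℂ ↥(𝒥 ⊓ S ν) := by
    intro t ν
    have h := hrk t k hk ν
    have e1 : annihilatorOfDegree (P' t) k ∩
        {D : MvPolynomial (Fin m × Fin m) ℂ | ∀ e ∈ D.support, ν ≤ Finsupp.weight μ e} =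
        ((𝒜 t ⊓ S ν : Submodule ℂ (MvPolynomial (Fin m × Fin m) ℂ)) : Set _) := by
      ext D
      simp only [Set.mem_inter_iff, Set.mem_setOf_eq, Submodule.coe_inf, SetLike.mem_coe, hmemA, hS]
    have e2 : J k ∩ {D : MvPolynomial (Fin m × Fin m) ℂ | ∀ e ∈ D.support, ν ≤ Finsupp.weight μ e} =
        ((𝒥 ⊓ S ν : Submodule ℂ (MvPolynomial (Fin m × Fin m) ℂ)) : Set _) := by
      ext D
      simp only [Set.mem_inter_iff, Set.mem_setOf_eq, Submodule.coe_inf, SetLike.mem_coe, hmemJ, hS]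
    rwa [e1, e2, Submodule.span_eq, Submodule.span_eq] at h
  -- Step 1: the filtered pieces converge
  have hLs1 : ∀ (ν : ℤ) (D : MvPolynomial (Fin m × Fin m) ℂ) (φ : ℕ → ℕ)
      (Ds : ℕ → MvPolynomial (Fin m × Fin m) ℂ), StrictMono φ → (∀ t, Ds t ∈ 𝒜 (φ t) ⊓ S ν) →
      Tendsto (fun t => coeffVec (Ds t)) atTop (𝓝 (coeffVec D)) → D ∈ 𝒥 ⊓ S ν := by
    intro ν D φ Ds hφ hDs hl
    refine Submodule.mem_inf.2 ⟨(hmemJ D).2 (hlim.mem_of_tendsto hk hφ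
      (fun t => (hmemA _ _).1 (Submodule.mem_inf.1 (hDs t)).1) hl),
      cr_mem_filt_of_tendsto hS (fun t => (Submodule.mem_inf.1 (hDs t)).2) hl⟩
  have hLi1 : ∀ ν : ℤ, ∀ D ∈ 𝒥 ⊓ S ν, ∃ Ds : ℕ → MvPolynomial (Fin m × Fin m) ℂ,
      (∀ t, Ds t ∈ 𝒜 t ⊓ S ν) ∧ Tendsto (fun t => coeffVec (Ds t)) atTop (𝓝 (coeffVec D)) :=
    fun ν => cr_coeff_li_of_ls (k := k) _ (fun t => 𝒜 t ⊓ S ν) (𝒥 ⊓ S ν)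
      (fun t => inf_le_left.trans (h𝒜hom t)) (inf_le_left.trans h𝒥hom) (fun t => hrank t ν) rfl
      (hLs1 ν)
  -- Step 2: the graded pieces converge
  haveI : Module.Finite ℂ (homogeneousSubmodule (Fin m × Fin m) ℂ k) :=
    Module.Finite.iff_fg.2 (homogeneousSubmodule_fg (Fin m × Fin m) ℂ k)
  have key : ∀ (ν : ℤ) (p : Submodule ℂ (MvPolynomial (Fin m × Fin m) ℂ)),
      p ≤ homogeneousSubmodule (Fin m × Fin m) ℂ k →
      Module.finrank ℂ ↥(p.map (weightedHomogeneousComponent μ ν)) +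
        Module.finrank ℂ ↥(p ⊓ LinearMap.ker (weightedHomogeneousComponent μ ν)) =
        Module.finrank ℂ ↥p := by
    intro ν p hp
    haveI : FiniteDimensional ℂ p := Submodule.finiteDimensional_of_le hp
    rw [← LinearMap.range_domRestrict, ← Submodule.map_comap_subtype,
      Submodule.finrank_map_subtype_eq, ← LinearMap.ker_domRestrict]
    exact LinearMap.finrank_range_add_finrank_ker _
  have hdimI : ∀ t ν, Module.finrank ℂ ↥((𝒜 t ⊓ S ν).map (weightedHomogeneousComponent μ ν)) =
      Module.finrank ℂ ↥((𝒥 ⊓ S ν).map (weightedHomogeneousComponent μ ν)) := by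
    intro t ν
    have h1 := key ν (𝒜 t ⊓ S ν) (inf_le_left.trans (h𝒜hom t))
    have h2 := key ν (𝒥 ⊓ S ν) (inf_le_left.trans h𝒥hom)
    rw [inf_assoc, cr_filt_inf_ker hS] at h1 h2
    have h3 := hrank t ν
    have h4 := hrank t (ν + 1)
    omega
  have hIhom : ∀ t ν, (𝒜 t ⊓ S ν).map (weightedHomogeneousComponent μ ν) ≤
      homogeneousSubmodule (Fin m × Fin m) ℂ k := fun t ν =>
    Submodule.map_le_iff_le_comap.2 fun D hD =>
      cr_comp_mem_homogeneousSubmodule ν (h𝒜hom t (Submodule.mem_inf.1 hD).1)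
  have hNhom : ∀ ν, (𝒥 ⊓ S ν).map (weightedHomogeneousComponent μ ν) ≤
      homogeneousSubmodule (Fin m × Fin m) ℂ k := fun ν =>
    Submodule.map_le_iff_le_comap.2 fun D hD =>
      cr_comp_mem_homogeneousSubmodule ν (h𝒥hom (Submodule.mem_inf.1 hD).1)
  have hLi2 : ∀ ν : ℤ, ∀ y ∈ (𝒥 ⊓ S ν).map (weightedHomogeneousComponent μ ν),
      ∃ ys : ℕ → MvPolynomial (Fin m × Fin m) ℂ,
        (∀ t, ys t ∈ (𝒜 t ⊓ S ν).map (weightedHomogeneousComponent μ ν)) ∧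
        Tendsto (fun t => coeffVec (ys t)) atTop (𝓝 (coeffVec y)) := by
    intro ν y hy
    obtain ⟨D, hD, rfl⟩ := Submodule.mem_map.1 hy
    obtain ⟨Ds, hDs, hl⟩ := hLi1 ν D hD
    exact ⟨fun t => weightedHomogeneousComponent μ ν (Ds t),
      fun t => Submodule.mem_map_of_mem (hDs t), cr_tendsto_coeffVec_comp ν hl⟩
  have hLs2 : ∀ (ν : ℤ) (y : MvPolynomial (Fin m × Fin m) ℂ) (φ : ℕ → ℕ)
      (ys : ℕ → MvPolynomial (Fin m × Fin m) ℂ), StrictMono φ →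
      (∀ t, ys t ∈ (𝒜 (φ t) ⊓ S ν).map (weightedHomogeneousComponent μ ν)) →
      Tendsto (fun t => coeffVec (ys t)) atTop (𝓝 (coeffVec y)) →
      y ∈ (𝒥 ⊓ S ν).map (weightedHomogeneousComponent μ ν) :=
    fun ν => cellRetraction_coeff_ls_of_li k _
      (fun t => (𝒜 t ⊓ S ν).map (weightedHomogeneousComponent μ ν))
      ((𝒥 ⊓ S ν).map (weightedHomogeneousComponent μ ν)) (fun t => hIhom t ν) (hNhom ν)
      (fun t => hdimI t ν) rfl (hLi2 ν)
  -- Step 3: assemble.  The graded pieces sit inside the initial span ...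
  have hIN : ∀ t ν, (𝒜 t ⊓ S ν).map (weightedHomogeneousComponent μ ν) ≤
      Submodule.span ℂ {D' : MvPolynomial (Fin m × Fin m) ℂ |
        ∃ E ∈ annihilatorOfDegree (P' t) k, ∃ ν : ℤ, D' = weightedHomogeneousComponent μ ν E ∧
          ∀ ν' : ℤ, ν' < ν → weightedHomogeneousComponent μ ν' E = 0} := by
    intro t ν
    refine Submodule.map_le_iff_le_comap.2 fun E hE => ?_
    obtain ⟨hEA, hES⟩ := Submodule.mem_inf.1 hE
    exact Submodule.subset_span ⟨E, (hmemA t E).1 hEA, ν, rfl,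
      fun ν' hν' => cr_comp_eq_zero_of_mem_filt hS hES hν'⟩
  -- ... and the initial span projects into the graded pieces
  have hINle : ∀ t ν, Submodule.span ℂ {D' : MvPolynomial (Fin m × Fin m) ℂ |
        ∃ E ∈ annihilatorOfDegree (P' t) k, ∃ ν : ℤ, D' = weightedHomogeneousComponent μ ν E ∧
          ∀ ν' : ℤ, ν' < ν → weightedHomogeneousComponent μ ν' E = 0} ≤
      ((𝒜 t ⊓ S ν).map (weightedHomogeneousComponent μ ν)).comap
        (weightedHomogeneousComponent μ ν) := by
    intro t ν
    rw [Submodule.span_le]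
    rintro _ ⟨E, hE, ν₀, rfl, hlow⟩
    simp only [SetLike.mem_coe, Submodule.mem_comap]
    rw [weightedHomogeneousComponent_of_mem (weightedHomogeneousComponent_mem μ E ν₀)]
    split_ifs with h
    · subst h
      exact Submodule.mem_map_of_mem
        (Submodule.mem_inf.2 ⟨(hmemA t E).2 hE, cr_mem_filt_of_comp_eq_zero hS hlow⟩)
    · exact Submodule.zero_mem _
  -- the graded pieces of `J k`
  have hπN : ∀ ν : ℤ, ∀ D ∈ 𝒥,
      weightedHomogeneousComponent μ ν D ∈ (𝒥 ⊓ S ν).map (weightedHomogeneousComponent μ ν) := by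
    intro ν D hD
    refine Submodule.mem_map.2 ⟨weightedHomogeneousComponent μ ν D, Submodule.mem_inf.2
      ⟨(hmemJ _).2 (hgr k hk D ((hmemJ D).1 hD) ν), cr_comp_mem_filt hS ν D⟩, ?_⟩
    rw [weightedHomogeneousComponent_of_mem (weightedHomogeneousComponent_mem μ D ν), if_pos rfl]
  have hN𝒥 : ∀ ν : ℤ, (𝒥 ⊓ S ν).map (weightedHomogeneousComponent μ ν) ≤ 𝒥 := fun ν =>
    Submodule.map_le_iff_le_comap.2 fun D hD =>
      (hmemJ _).2 (hgr k hk D ((hmemJ D).1 (Submodule.mem_inf.1 hD).1) ν)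
  constructor
  · -- (Li)
    intro D hDJ
    have hD : D ∈ 𝒥 := (hmemJ D).2 hDJ
    have hys : ∀ ν : ℤ, ∃ ys : ℕ → MvPolynomial (Fin m × Fin m) ℂ,
        (∀ t, ys t ∈ (𝒜 t ⊓ S ν).map (weightedHomogeneousComponent μ ν)) ∧
        Tendsto (fun t => coeffVec (ys t)) atTop
          (𝓝 (coeffVec (weightedHomogeneousComponent μ ν D))) :=
      fun ν => hLi2 ν _ (hπN ν D hD)
    choose ys hysI hyslim using hys
    refine ⟨fun t => ∑ ν ∈ D.support.image (Finsupp.weight μ), ys ν t,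
      fun t => Submodule.sum_mem _ fun ν _ => hIN t ν (hysI ν t), ?_⟩
    have e1 : coeffVec D = ∑ ν ∈ D.support.image (Finsupp.weight μ),
        coeffVec (weightedHomogeneousComponent μ ν D) := by
      rw [← cr_coeffVec_sum, cr_sum_comp]
    rw [e1]
    simp only [cr_coeffVec_sum]
    exact tendsto_finsetSum _ fun ν _ => hyslim ν
  · -- (Ls)
    intro D φ Ds hφ hDs hl
    have hπD : ∀ ν : ℤ, weightedHomogeneousComponent μ ν D ∈ 𝒥 := fun ν =>
      hN𝒥 ν (hLs2 ν _ φ (fun t => weightedHomogeneousComponent μ ν (Ds t)) hφ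
        (fun t => hINle (φ t) ν (hDs t)) (cr_tendsto_coeffVec_comp ν hl))
    rw [← hmemJ, ← cr_sum_comp (μ := μ) D]
    exact Submodule.sum_mem _ fun ν _ => hπD ν

/-- **S3 — sequential continuity of the Białynicki-Birula retraction on a constant-rank stratum.**
If `Ann_•(P'_t) → J` degree-wise (`k ≤ m`), `J` is `μ`-graded, and for all `t`, `k ≤ m`, `ν` the
`μ`-filtration rank `dim span(Ann_k(P'_t) ∩ S_{≥ν})` equals that of `J k`, then the initial spans
`in_μ(Ann_k(P'_t))` (spans of lowest-`μ`-weight forms) Kuratowski-converge to `J` as well, in the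
coefficient topology: the filtered pieces `A_t ∩ S_{≥ν} → J_k ∩ S_{≥ν}` by sequential compactness of
the Grassmannian and the pinned dimension; project to weight `ν` (dimensions `r_ν - r_{ν+1}` pinned,
`π_ν` continuous); sum over the finitely many weights.  No orbit or fixedness hypothesis.
[folklore] -/
theorem stub_cellRetraction :
    ∀ (m : ℕ) (J : ℕ → Set (MvPolynomial (Fin m × Fin m) ℂ)) (μ : Fin m × Fin m → ℤ)
      (P' : ℕ → MvPolynomial (Fin m × Fin m) ℂ),
      IsBorderApolarLimit m P' J →
      (∀ k ≤ m, ∀ D ∈ J k, ∀ ν : ℤ, weightedHomogeneousComponent μ ν D ∈ J k) →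
      (∀ t : ℕ, ∀ k ≤ m, ∀ ν : ℤ,
          Module.finrank ℂ ↥(Submodule.span ℂ (annihilatorOfDegree (P' t) k ∩
            {D : MvPolynomial (Fin m × Fin m) ℂ | ∀ e ∈ D.support, ν ≤ Finsupp.weight μ e})) =
          Module.finrank ℂ ↥(Submodule.span ℂ (J k ∩
            {D : MvPolynomial (Fin m × Fin m) ℂ | ∀ e ∈ D.support, ν ≤ Finsupp.weight μ e}))) →
      (∀ k ≤ m, ∀ D ∈ J k, ∃ Ds : ℕ → MvPolynomial (Fin m × Fin m) ℂ,
          (∀ t, Ds t ∈ Submodule.span ℂ {D' : MvPolynomial (Fin m × Fin m) ℂ |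
              ∃ E ∈ annihilatorOfDegree (P' t) k, ∃ ν : ℤ, D' = weightedHomogeneousComponent μ ν E ∧
                ∀ ν' : ℤ, ν' < ν → weightedHomogeneousComponent μ ν' E = 0}) ∧
            Filter.Tendsto (fun t => coeffVec (Ds t)) Filter.atTop (nhds (coeffVec D))) ∧
      (∀ k ≤ m, ∀ (D : MvPolynomial (Fin m × Fin m) ℂ) (φ : ℕ → ℕ) (Ds : ℕ → MvPolynomial (Fin m × Fin m) ℂ),
          StrictMono φ →
          (∀ t, Ds t ∈ Submodule.span ℂ {D' : MvPolynomial (Fin m × Fin m) ℂ |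
              ∃ E ∈ annihilatorOfDegree (P' (φ t)) k, ∃ ν : ℤ, D' = weightedHomogeneousComponent μ ν E ∧
                ∀ ν' : ℤ, ν' < ν → weightedHomogeneousComponent μ ν' E = 0}) →
          Filter.Tendsto (fun t => coeffVec (Ds t)) Filter.atTop (nhds (coeffVec D)) → D ∈ J k) := by
  intro m J μ P' hlim hgr hrk
  exact ⟨fun k hk => (cr_core m J μ P' hlim hgr hrk k hk).1,
    fun k hk => (cr_core m J μ P' hlim hgr hrk k hk).2⟩

end Main

end Summit.ValiantsHypothesis.ValiantsHypothesis.Theorems.BorderApolarityToricFixedPoints
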